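import Literature.Analysis.FluidPDE.ChenTsaiZhang2022LocalRegularity
import HarnessLib.Audit
import HarnessLib

/-!
# SwirlDecrementLaw — the one-scale swirl decrement law, typed; the Burgers vortex forbids every
# polynomial law (ROUND-14, seat nsreg-p2)

**The object.**  Every slightly-supercritical axis-regularity criterion in print for axisymmetric
suitable weak solutions (Pan 2016, Seregin 2020/2022, Chen–Tsai–Zhang 2022 = arXiv:2201.01766
Prop. 1.2, Lei–Ren 2024 Thm. 4) runs the same engine on the swirl `Γ = r u^θ`, which solves
`∂ₜΓ + b·∇Γ + (2/r)∂ᵣΓ = ΔΓ` with the poloidal drift `b`: a ONE-SCALE OSCILLATION DECREMENT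
`osc_{Q(z₀,R/4)} Γ ≤ (1 - Λ(A(z₀,R))) · osc_{Q(z₀,R)} Γ` at axis points `z₀`, whose size `Λ`
depends only on the scaled energy `A(z₀,R) = sup_t R⁻¹ ∫_{B_R} |u|²` of the flow at that scale.
`SwirlDecrementLaw Λ` is that statement with the PROFILE `Λ : ℝ → ℝ` as the parameter
(essential ranges rendered as a.e. confinement to intervals; frame = the tree's CTZ frame
`IsSuitableWeakSolutionInBall 1 0`, `parabolicCylinder`, `cknA`, `swirl`, `cylRadius`).

**The located law is exponential.**  Chen–Tsai–Zhang's proof (arXiv:2201.01766 pp. 8–9, Lemmas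
2.1–2.4: Moser bound `sup |Γ| ≤ N((1+A)/R)^{5/2}‖Γ‖₂`, weak-Harnack entropy bound
`-∫ ln h ≤ N(1+A)³`, Chebyshev) makes the decrement `λ/4` admissible iff
`N (1+A)^4 (-ln λ)^{-1/2} ≤ 1/2`, i.e. `Λ(A) = ¼ exp(-C (1+A)^θ)` with `θ = 8`
(`ExpDecrementLaw 8`, a printed PROOF STEP, not a printed theorem — typing request T-14.1);
the admissible iterated-log power of every criterion built on it is `1/θ` (their `β < 1/8`;
`α₀ = βγ/(6+2γ) = 1/112` is bookkeeping, Lemma 4.1), by the calculus of the sibling module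
`SwirlDecrementCalculus` (`expLaw_logGrowth_minorant`, `expLaw_powerGrowth_summable`).

**The Burgers vortex is the extremal object.**  The steady Burgers vortex with strain `s` and
circulation `2πG`, `u = s(-x₁/2, -x₂/2, x₃) + (G(1 - e^{-s r²/4})/r²)(-x₂, x₁, 0)`, is a smooth
steady axisymmetric Navier–Stokes solution, hence suitable in `Q(1)`; at an axis point and scale
`R` its scaled energy is `(2π/5)(sR²)² + O(G² ln s)` while its swirl oscillation only drops from
`G(1 - e^{-sR²/4})` on `Q(R)` to `G(1 - e^{-sR²/64})` on `Q(R/4)`: decrement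
`≤ e^{-S/64}/(1 - e^{-S/4})`, `S = sR²`, at energy `≍ S²`.  Hence (`not_polyDecrementLaw_of_burgers`)
NO POLYNOMIAL LAW `Λ(A) = c(1+A)^{-p}` holds, and no exponential law with `θ < 1/2`: the true
exponent of the one-scale law lies in `[1/2, 8]`.  By `SwirlDecrementCalculus.polyLaw_powerGrowth_harmonic`
a polynomial law is exactly what would have turned Lei–Ren's open `|ln r|`-growth (Adv. Math. 457
(2024), p. 6: «`(ln|ln r|)^μ` … replaced by `|ln r|`», `μ` an unspecified absolute constant in
their Thm. 4) into a modulus; by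
`expLaw_powerGrowth_summable` no exponential law does, for any `θ`.  PURPOSE-LITERAL VERDICT of the
round: inside the family {one-scale decrement valid for every suitable axisymmetric solution at
every axis scale, gauged by a polynomial of the scaled energy} the only improvable exponent is
`θ : 8 → θ* ≥ 1/2`, worth the iterated-log power `1/8 → 1/θ* ≤ 2`; NO value of `θ` crosses
`ln ln → ln`.  The Burgers facts are packaged as ONE named classical statement `BurgersWitnessWith D` (energy
constant `D`; `BurgersWitness` = the sharp `D = 2π/5`, cheap target `D = 4π/3`)
(typing request T-14.2b: explicit smooth steady solution ⇒ `IsSuitableWeakSolutionInBall`); the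
refutation `BurgersWitness → ¬ PolyDecrementLaw p` and the real-analysis core
(`exists_exp_lt_polyLaw`) are kernel-checked here.

This file: §1 the law, its profiles and the typed nodes; §2 the real-analysis core of the Burgers
computation.  The witness package `BurgersWitnessWith D` and the refutations are in the sibling
`…Theorems.SwirlDecrementLawBurgers` (split for the 400-line rule).
Memo: `run/shared/lean/pub/ns-regularity-ideate/ns-regularity-ideate-p2/ROUND-14.md`.
-/

namespace Summit.NavierStokesRegularity.NavierStokesRegularity.Theorems.SwirlDecrementLaw

open MeasureTheory Set Filter Topology Metric
open scoped ENNReal NNReal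
open Literature.Analysis.FluidPDE Literature.Analysis.FluidPDE.ChenTsaiZhang2022


noncomputable section

/-! ## 1. The one-scale decrement law with profile `Λ` -/

/-- **ONE-SCALE SWIRL DECREMENT LAW with profile `Λ`.**  For every axisymmetric suitable weak
solution `(u, p)` in `Q(1)`, every axis point `z₀ ∈ Q(1/8)`, every scale `0 < R ≤ 1/4` and every
`M ≥ 0` bounding the scaled energy `A(z₀, R) = cknA R z₀ u ≤ M`: if the swirl `Γ = r u^θ` lies in
`[a, b]` a.e. on `Q(z₀, R)`, then it lies a.e. on `Q(z₀, R/4)` in an interval `[a', b']` of length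
`b' - a' ≤ (1 - Λ M)(b - a)`.  (Chen–Tsai–Zhang 2022 Lemma 2.4 + p. 9 give it with
`Λ = expLaw 8 C`; trivially true where `Λ M ≤ 0`, trivially false where `Λ M > 1`.) -/
def SwirlDecrementLaw (Λ : ℝ → ℝ) : Prop :=
  ∀ (u : ℝ → (EuclideanSpace ℝ (Fin 3)) → (EuclideanSpace ℝ (Fin 3))) (p : ℝ → (EuclideanSpace ℝ (Fin 3)) → ℝ),
    IsSuitableWeakSolutionInBall 1 0 u p →
    (∀ t ∈ Ioo (-1 : ℝ) 0, IsAxisymmetric (u t)) →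
    (∀ t ∈ Ioo (-1 : ℝ) 0, IsAxisymmetricScalar (p t)) →
    ∀ z₀ ∈ parabolicCylinder (1 / 8) (0 : ℝ × (EuclideanSpace ℝ (Fin 3))), cylRadius z₀.2 = 0 →
    ∀ R : ℝ, 0 < R → R ≤ 1 / 4 →
    ∀ M : ℝ, 0 ≤ M → cknA R z₀ u ≤ ENNReal.ofReal M →
    ∀ a b : ℝ, a ≤ b →
    (∀ᵐ z ∂(volume.restrict (parabolicCylinder R z₀)), swirl (u z.1) z.2 ∈ Icc a b) →
    ∃ a' b' : ℝ, a' ≤ b' ∧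
      (∀ᵐ z ∂(volume.restrict (parabolicCylinder (R / 4) z₀)), swirl (u z.1) z.2 ∈ Icc a' b') ∧
      b' - a' ≤ (1 - Λ M) * (b - a)

/-- A law with a smaller profile is a weaker statement. -/
theorem SwirlDecrementLaw.anti {Λ₁ Λ₂ : ℝ → ℝ} (hle : ∀ M : ℝ, 0 ≤ M → Λ₁ M ≤ Λ₂ M)
    (h : SwirlDecrementLaw Λ₂) : SwirlDecrementLaw Λ₁ := by
  intro u p hsws haxi haxip z₀ hz₀ hax R hR hR4 M hM hA a b hab hconf
  obtain ⟨a', b', ha'b', hconf', hdec⟩ := h u p hsws haxi haxip z₀ hz₀ hax R hR hR4 M hM hA a b hab hconf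
  refine ⟨a', b', ha'b', hconf', hdec.trans ?_⟩
  exact mul_le_mul_of_nonneg_right (by linarith [hle M hM]) (by linarith)

/-- The EXPONENTIAL profile `Λ(M) = ¼ exp(-C (1+M)^θ)` (Chen–Tsai–Zhang: `θ = 8`). -/
def expLaw (θ C : ℝ) : ℝ → ℝ := fun M => Real.exp (-(C * (1 + M) ^ θ)) / 4

/-- The POLYNOMIAL profile `Λ(M) = c (1+M)^{-p}`. -/
def polyLaw (p c : ℝ) : ℝ → ℝ := fun M => c * (1 + M) ^ (-p)

/-- **EXPONENTIAL DECREMENT LAW with exponent `θ`**: some `C > 0` makes `¼ e^{-C(1+A)^θ}` an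
admissible one-scale swirl decrement.  STATUS BY `θ`: `θ = 8` — Chen–Tsai–Zhang 2022, proof of
Prop. 1.2 (arXiv:2201.01766 pp. 8–9; a proof step, typing request T-14.1); `θ ≥ 8` — follows
(`ExpDecrementLaw.mono`); `θ < 1/2` — FALSE by the Burgers vortex (decrement `≤ 2e^{-S/64}` at
energy `(2π/5)S² + 1`, module docstring); `1/2 ≤ θ < 8` — OPEN, the improvable exponent of ladder C
of ROUND-13: the admissible iterated-log power of the resulting criterion is exactly `1/θ`
(`SwirlDecrementCalculus.expLaw_logGrowth_minorant`). -/
@[conjecture] def ExpDecrementLaw (θ : ℝ) : Prop := ∃ C : ℝ, 0 < C ∧ SwirlDecrementLaw (expLaw θ C)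

/-- **POLYNOMIAL DECREMENT LAW with exponent `p`** — the law that would turn Lei–Ren's `|ln r|^μ`
growth (`μ p ≤ 1`) into a modulus (`SwirlDecrementCalculus.polyLaw_powerGrowth_harmonic`).
REFUTED for every `p > 0` given the Burgers facts: `not_polyDecrementLaw_of_burgers`. -/
def PolyDecrementLaw (p : ℝ) : Prop := ∃ c : ℝ, 0 < c ∧ SwirlDecrementLaw (polyLaw p c)

/-- Larger `θ` = smaller profile on `M ≥ 0`. -/
theorem expLaw_anti {θ₁ θ₂ C : ℝ} (hθ : θ₁ ≤ θ₂) (hC : 0 ≤ C) {M : ℝ} (hM : 0 ≤ M) :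
    expLaw θ₂ C M ≤ expLaw θ₁ C M := by
  unfold expLaw
  have h : (1 + M) ^ θ₁ ≤ (1 + M) ^ θ₂ := Real.rpow_le_rpow_of_exponent_le (by linarith) hθ
  have := mul_le_mul_of_nonneg_left h hC
  exact div_le_div_of_nonneg_right (Real.exp_le_exp.2 (by linarith)) (by norm_num)

/-- The exponential laws are nested: `ExpDecrementLaw θ₁ → ExpDecrementLaw θ₂` for `θ₁ ≤ θ₂`
(so `θ = 8` is the weakest located one and the Burgers floor `θ = 1/2` the strongest possible). -/
theorem ExpDecrementLaw.mono {θ₁ θ₂ : ℝ} (hθ : θ₁ ≤ θ₂) (h : ExpDecrementLaw θ₁) :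
    ExpDecrementLaw θ₂ := by
  obtain ⟨C, hC, hlaw⟩ := h
  exact ⟨C, hC, hlaw.anti fun M hM => expLaw_anti hθ hC.le hM⟩

/-- The polynomial laws are nested the other way: `PolyDecrementLaw p₁ → PolyDecrementLaw p₂` for
`p₁ ≤ p₂`. -/
theorem PolyDecrementLaw.mono {p₁ p₂ : ℝ} (hp : p₁ ≤ p₂) (h : PolyDecrementLaw p₁) :
    PolyDecrementLaw p₂ := by
  obtain ⟨c, hc, hlaw⟩ := h
  refine ⟨c, hc, hlaw.anti fun M hM => ?_⟩
  unfold polyLaw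
  exact mul_le_mul_of_nonneg_left
    (Real.rpow_le_rpow_of_exponent_le (by linarith) (by linarith)) hc.le

/-! ## 2. The Burgers vortex: real-analysis core -/

/-- The swirl profile of the steady Burgers vortex with strain `s` and circulation `2πG`:
`Γ_B(r) = G (1 - e^{-s r²/4})` (it solves `-(s r/2) Γ' = Γ'' - Γ'/r`, the steady swirl equation
with drift `b = s(-r/2, z)`; vorticity `ω₃ = (sG/2) e^{-s r²/4}`, core width `2/√s`). -/
def burgersSwirl (s G r : ℝ) : ℝ := G * (1 - Real.exp (-(s * r ^ 2 / 4)))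

/-- The Burgers swirl profile vanishes on the axis. -/
theorem burgersSwirl_zero (s G : ℝ) : burgersSwirl s G 0 = 0 := by simp [burgersSwirl]

/-- The Burgers swirl profile is nonnegative for `s, G ≥ 0`. -/
theorem burgersSwirl_nonneg {s G r : ℝ} (hs : 0 ≤ s) (hG : 0 ≤ G) : 0 ≤ burgersSwirl s G r := by
  unfold burgersSwirl
  refine mul_nonneg hG ?_
  have : Real.exp (-(s * r ^ 2 / 4)) ≤ 1 := Real.exp_le_one_iff.2 (by
    have := mul_nonneg hs (sq_nonneg r); linarith)
  linarith

/-- `Γ_B` is monotone in `r ≥ 0`: its range on `[0, ρ]` is `[0, Γ_B(ρ)]`, so the (essential)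
oscillation of the Burgers swirl on `Q(z₀, ρ)`, `z₀` on the axis, is `G(1 - e^{-sρ²/4})`. -/
theorem burgersSwirl_mono {s G : ℝ} (hs : 0 ≤ s) (hG : 0 ≤ G) {r₁ r₂ : ℝ} (hr₁ : 0 ≤ r₁)
    (h : r₁ ≤ r₂) : burgersSwirl s G r₁ ≤ burgersSwirl s G r₂ := by
  unfold burgersSwirl
  refine mul_le_mul_of_nonneg_left ?_ hG
  have : s * r₁ ^ 2 / 4 ≤ s * r₂ ^ 2 / 4 := by
    have := mul_le_mul_of_nonneg_left (pow_le_pow_left₀ hr₁ h 2) hs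
    linarith
  linarith [Real.exp_le_exp.2 (neg_le_neg this)]

/-- `e^{-S/4} ≤ 1/2` for `S ≥ 8`. -/
theorem exp_neg_quarter_le_half {S : ℝ} (hS : 8 ≤ S) : Real.exp (-(S / 4)) ≤ 1 / 2 := by
  have h1 : Real.exp (-(S / 4)) ≤ Real.exp (-2) := Real.exp_le_exp.2 (by linarith)
  have h2 : Real.exp (-2) ≤ 1 / 2 := by
    have h3 : (3 : ℝ) ≤ Real.exp 2 := by
      have := Real.add_one_le_exp (2 : ℝ)
      linarith
    have h4 : Real.exp (-2) * Real.exp 2 = 1 := by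
      rw [← Real.exp_add]
      norm_num
    have h5 := mul_le_mul_of_nonneg_left h3 (Real.exp_pos (-2 : ℝ)).le
    linarith
  exact h1.trans h2

/-- **The Burgers decrement at scaled strain `S = sR² ≥ 8`**: passing from `Q(R)` (oscillation
`G(1 - e^{-S/4})`) to `Q(R/4)` (oscillation `G(1 - e^{-S/64})`) decreases the oscillation by the
factor `1 - δ` with `δ = 1 - (1 - e^{-S/64})/(1 - e^{-S/4}) ≤ 2 e^{-S/64}` — while the scaled energy
is `(2π/5) S² + O(G² ln s)`. -/
theorem burgers_decrement_le {S : ℝ} (hS : 8 ≤ S) :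
    1 - (1 - Real.exp (-(S / 64))) / (1 - Real.exp (-(S / 4))) ≤ 2 * Real.exp (-(S / 64)) := by
  have hE4 := exp_neg_quarter_le_half hS
  have hpos : 0 < 1 - Real.exp (-(S / 4)) := by linarith
  have h64 : 0 ≤ Real.exp (-(S / 64)) := (Real.exp_pos _).le
  have h4 : 0 ≤ Real.exp (-(S / 4)) := (Real.exp_pos _).le
  have key : (1 - 2 * Real.exp (-(S / 64))) * (1 - Real.exp (-(S / 4))) ≤
      1 - Real.exp (-(S / 64)) := by
    nlinarith [mul_nonneg h64 (by linarith : (0 : ℝ) ≤ 1 / 2 - Real.exp (-(S / 4)))]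
  have := (le_div_iff₀ hpos).2 key
  linarith

/-- **No polynomial profile survives the Burgers decrement**: for `c, p > 0`, `D ≥ 0` there is
`S ≥ 8` with `2 e^{-S/64} < c (2 + D S²)^{-p}`. -/
theorem exists_exp_lt_polyLaw {c p D : ℝ} (hc : 0 < c) (hp : 0 < p) (hD : 0 ≤ D) :
    ∃ S : ℝ, 8 ≤ S ∧ 2 * Real.exp (-(S / 64)) < c * (2 + D * S ^ 2) ^ (-p) := by
  obtain ⟨n, hn⟩ : ∃ n : ℕ, 2 * p ≤ (n : ℝ) := ⟨⌈2 * p⌉₊, Nat.le_ceil _⟩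
  have hL0 : (0 : ℝ) < 2 + 4096 * D := by linarith
  have hε : 0 < c / (2 * (2 + 4096 * D) ^ p) := by positivity
  obtain ⟨x, hx, hx1⟩ :=
    (((Real.tendsto_pow_mul_exp_neg_atTop_nhds_zero n).eventually (eventually_lt_nhds hε)).and
      (eventually_ge_atTop (1 : ℝ))).exists
  have hx0 : 0 < x := by linarith
  refine ⟨64 * x, by linarith, ?_⟩
  have hxn : 0 < x ^ n := pow_pos hx0 n
  have key : x ^ n * Real.exp (-x) * (2 * (2 + 4096 * D) ^ p) < c :=
    (lt_div_iff₀ (by positivity)).1 hx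
  have h1 : 2 * Real.exp (-x) < c / ((2 + 4096 * D) ^ p * x ^ n) := by
    rw [lt_div_iff₀ (by positivity)]
    calc 2 * Real.exp (-x) * ((2 + 4096 * D) ^ p * x ^ n)
        = x ^ n * Real.exp (-x) * (2 * (2 + 4096 * D) ^ p) := by ring
      _ < c := key
  have hx2 : 1 ≤ x ^ 2 := by nlinarith
  have e1 : (x ^ 2) ^ p ≤ x ^ n := by
    rw [← Real.rpow_natCast x 2, ← Real.rpow_mul hx0.le, ← Real.rpow_natCast x n]
    exact Real.rpow_le_rpow_of_exponent_le hx1 (by push_cast; linarith)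
  have e2 : ((2 + 4096 * D) * x ^ 2) ^ (-p) ≤ (2 + D * (64 * x) ^ 2) ^ (-p) :=
    Real.rpow_le_rpow_of_nonpos (by positivity) (by nlinarith [hx2]) (by linarith)
  have e3 : ((2 + 4096 * D) * x ^ 2) ^ (-p) = ((2 + 4096 * D) ^ p)⁻¹ * ((x ^ 2) ^ p)⁻¹ := by
    rw [Real.mul_rpow hL0.le (by positivity), Real.rpow_neg hL0.le, Real.rpow_neg (by positivity)]
  calc 2 * Real.exp (-(64 * x / 64)) = 2 * Real.exp (-x) := by
        rw [show (64 : ℝ) * x / 64 = x by ring]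
    _ < c / ((2 + 4096 * D) ^ p * x ^ n) := h1
    _ = c * (((2 + 4096 * D) ^ p)⁻¹ * (x ^ n)⁻¹) := by rw [div_eq_mul_inv, mul_inv]
    _ ≤ c * (((2 + 4096 * D) ^ p)⁻¹ * ((x ^ 2) ^ p)⁻¹) :=
        mul_le_mul_of_nonneg_left
          (mul_le_mul_of_nonneg_left (inv_anti₀ (by positivity) e1) (by positivity)) hc.le
    _ = c * ((2 + 4096 * D) * x ^ 2) ^ (-p) := by rw [e3]
    _ ≤ c * (2 + D * (64 * x) ^ 2) ^ (-p) := mul_le_mul_of_nonneg_left e2 hc.le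

/-- **No exponential profile with `θ < 1/2` survives either**: for `C > 0`, `0 < θ < 1/2`, `D ≥ 0`
there is `S ≥ 8` with `2 e^{-S/64} < ¼ exp(-C (2 + D S²)^θ)`. -/
theorem exists_exp_lt_expLaw {C θ D : ℝ} (hC : 0 < C) (hθ0 : 0 < θ) (hθ : θ < 1 / 2)
    (hD : 0 ≤ D) :
    ∃ S : ℝ, 8 ≤ S ∧
      2 * Real.exp (-(S / 64)) < Real.exp (-(C * (2 + D * S ^ 2) ^ θ)) / 4 := by
  have hσ : 0 < 1 - 2 * θ := by linarith
  have hK : 0 < 128 * (C * (2 + D) ^ θ) := by positivity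
  obtain ⟨S, hSdef⟩ :
      ∃ S : ℝ, S = max 1024 ((128 * (C * (2 + D) ^ θ)) ^ (1 - 2 * θ)⁻¹) := ⟨_, rfl⟩
  have hS1024 : 1024 ≤ S := by rw [hSdef]; exact le_max_left _ _
  have hSK : (128 * (C * (2 + D) ^ θ)) ^ (1 - 2 * θ)⁻¹ ≤ S := by
    rw [hSdef]; exact le_max_right _ _
  refine ⟨S, by linarith, ?_⟩
  have hS0 : 0 < S := by linarith
  have h4 : 128 * (C * (2 + D) ^ θ) ≤ S ^ (1 - 2 * θ) := by
    have := Real.rpow_le_rpow (Real.rpow_nonneg hK.le _) hSK hσ.le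
    rwa [Real.rpow_inv_rpow hK.le hσ.ne'] at this
  have hS2 : 2 + D * S ^ 2 ≤ (2 + D) * S ^ 2 := by nlinarith
  have h1 : (2 + D * S ^ 2) ^ θ ≤ (2 + D) ^ θ * S ^ (2 * θ) := by
    calc (2 + D * S ^ 2) ^ θ ≤ ((2 + D) * S ^ 2) ^ θ :=
          Real.rpow_le_rpow (by positivity) hS2 hθ0.le
      _ = (2 + D) ^ θ * (S ^ 2) ^ θ := Real.mul_rpow (by linarith) (by positivity)
      _ = (2 + D) ^ θ * S ^ (2 * θ) := by
          rw [← Real.rpow_natCast S 2, ← Real.rpow_mul hS0.le]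
          norm_num
  have hSS : S ^ (1 - 2 * θ) * S ^ (2 * θ) = S := by
    rw [← Real.rpow_add hS0]
    simp
  have hbound : C * (2 + D * S ^ 2) ^ θ ≤ S / 128 := by
    have h2θ : 0 ≤ S ^ (2 * θ) := Real.rpow_nonneg hS0.le _
    calc C * (2 + D * S ^ 2) ^ θ ≤ C * ((2 + D) ^ θ * S ^ (2 * θ)) :=
          mul_le_mul_of_nonneg_left h1 hC.le
      _ = (128 * (C * (2 + D) ^ θ)) * S ^ (2 * θ) / 128 := by ring
      _ ≤ S ^ (1 - 2 * θ) * S ^ (2 * θ) / 128 :=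
          div_le_div_of_nonneg_right (mul_le_mul_of_nonneg_right h4 h2θ) (by norm_num)
      _ = S / 128 := by rw [hSS]
  have h128 : 8 < Real.exp (S / 128) := by
    have := Real.add_one_le_exp (S / 128)
    linarith
  have hexp : Real.exp (-(S / 128)) ≤ Real.exp (-(C * (2 + D * S ^ 2) ^ θ)) :=
    Real.exp_le_exp.2 (by linarith)
  have hsplit : Real.exp (-(S / 128)) = Real.exp (-(S / 64)) * Real.exp (S / 128) := by
    rw [← Real.exp_add]
    congr 1
    ring
  rw [lt_div_iff₀ (by norm_num : (0 : ℝ) < 4)]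
  calc 2 * Real.exp (-(S / 64)) * 4 = Real.exp (-(S / 64)) * 8 := by ring
    _ < Real.exp (-(S / 64)) * Real.exp (S / 128) := mul_lt_mul_of_pos_left h128 (Real.exp_pos _)
    _ = Real.exp (-(S / 128)) := hsplit.symm
    _ ≤ _ := hexp

end

end Summit.NavierStokesRegularity.NavierStokesRegularity.Theorems.SwirlDecrementLaw
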